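import Summits.QuantumFields.YangMills.Theorems.BalabanUVNodesN22W1RelCentredMembersOfDatum
import Literature.MathematicalPhysics.QuantumFieldTheory.Balaban1983to89.B13Bound226CentredRem

/-!
# BalabanUVNodes ∕ node N22 = NE9 — THE W1 OBJECT ON THE RELATIVE-DISC CENTRED ROAD (RE-TYPING M1′), MODULE J7b: THE CENTRED PIECE OF (S-vertex-T′)ʷ FOR THE MEMBER FAMILY OF THE
# DATUM, KERNEL-KEYED — dag-n10-c's torus-level centred (2.15)∕(2.26) `B13Bound226CentredRem.h226_torus_windowDilated_centred_of_primitives_exp` read at the datum's kernel record: the member of base point `s₀` minus the boxed reference member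
# with frozen potentials is `≤ s₀²·(weight·e^{a₅|Z|})` — the first piece of J7a §4's three-piece assembly of J2's `hMcen`

Cell `pub-ymgap`, HUMAN RULING D-0062 (Track A), R134 ACCELERATION re-seat `pub-ymgap-dag-n22-c` (strategy s1), generation 7, file J7b.  THEOREMS ONLY; imports J5
`…N22W1RelCentredMembersOfDatum` and dag-n10-c's `B13Bound226CentredRem` BY NAME.  `--supports` K3⁶ `SpineGivenEndpointR13SepCoPR` (stmt-QuantumFields-20509) as a helper.

WHY.  J2's `hMcen` at the datum = centred piece + box tail + `b`-free centre (J7a); THIS FILE is the centred piece, the only one carrying print's (2.15) on a centred integrand and the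
PARITY of the (2.14) data ([I] (2.10)–(2.13) pp. 267–268: after `B = g_kB′` the linear term vanishes and the exponent vanishes at `g_k = 0`; the second-order letter of the centred MEAN is
not printed — lens T21: it costs nothing beyond (2.15)).  The Taylor letters are those of the source theorem (lens E6: the exponential-moment edition `B13Bound226CentredRem` has
t-uniform inhabitants under the unscaled-field law; the linear-letter ★42B does not — the reading here is faithful to whichever source is named above).

HONEST FRAMING.  Count-neutral kernel-keyed reading of ONE landed theorem (no estimate proved here); every located input — kernel letters, parity and Taylor letters of the potentials,
box data, numerics — is a HYPOTHESIS; (S-vertex-T′) NOT PRINTED; nothing of Bałaban's asserted; N22 NOT discharged; one finite four-torus programme at fixed ε — NOT infinite volume,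
NOT OS on ℝ⁴, NOT a mass gap, NOT Clay.  0 `sorry`, 0 `def`, standard axioms.

References (TYPES only): [II] = [Balaban1988RG2Cluster] (1.41) p. 11, (2.14)–(2.26) pp. 15–17; [I] = [Balaban1987RG1] (2.9)–(2.13) pp. 266–268.
-/

noncomputable section

namespace YMDAG.N22.W1

open Set Metric Matrix
open scoped BigOperators
open Literature.MathematicalPhysics.QuantumFieldTheory.Balaban1983to89
open Literature.MathematicalPhysics.QuantumFieldTheory.Balaban1983to89.B13Term214 (term214 core214 F214)
open Literature.MathematicalPhysics.QuantumFieldTheory.Balaban1983to89.B13Bound226CentredRem (h226_torus_windowDilated_centred_of_primitives_exp)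
open Literature.MathematicalPhysics.QuantumFieldTheory.Balaban1983to89.TreeLengthTorus (TPt TDom tsys)
open Literature.MathematicalPhysics.QuantumFieldTheory.Balaban1983to89.B13Lemma3TorusTerms (weight)
open Literature.MathematicalPhysics.QuantumFieldTheory.Balaban1983to89.B13Bound143 (invTau)
open Literature.MathematicalPhysics.QuantumFieldTheory.Balaban1983to89.B9Thm37GlueTorus (tdist1)
open Literature.MathematicalPhysics.QuantumFieldTheory.Balaban1983to89.B5TorusCover (UT)
open Literature.MathematicalPhysics.QuantumFieldTheory.Balaban1983to89.Node00.Sect2 (domSys domCount CPair)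
open Literature.MathematicalPhysics.QuantumFieldTheory.Balaban1983to89.Node00.W1

variable {c₀ : B13.Consts} {P : Params} {𝔸 : Type*} {M k L : ℕ} [NeZero L] (𝔇 : TermDatum214 c₀ P 𝔸 M k L)
  (χu χcu : (Z : (domSys P M (k + 1)).Dom) → (t : TermLabel P M k L) → ((𝔇.𝒦 Z t).Λ → ℝ) → ℝ)
  (𝒲 : (Z : (domSys P M (k + 1)).Dom) → (t : TermLabel P M k L) → CPair P 𝔸 → TDom P.d (L * domCount P M (k + 1)) → ((𝔇.𝒦 Z t).Λ → ℝ) → ℂ)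
  (𝒪 : (Z : (domSys P M (k + 1)).Dom) → (t : TermLabel P M k L) → OlderTerms P 𝔸 M k → CPair P 𝔸 → TDom P.d (L * domCount P M (k + 1)) →
    ((𝔇.𝒦 Z t).Λ → ℝ) → ℂ)

open Classical in
/-- **THE CENTRED PIECE OF (S-vertex-T′)ʷ FOR THE MEMBER FAMILY OF THE DATUM, KERNEL-KEYED** — dag-n10-c's `B13Bound226CentredRem.h226_torus_windowDilated_centred_of_primitives_exp` (print's first estimate (2.15) on a
CENTRED integrand after the joint reflection `(B′, X) ↦ (−B′, −X)` has killed the odd first-order part; lens T21∕T23∕T26) at the datum's kernel record, for the window-dilated member of base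
point `s₀` at ONE dilation parameter `b ∈ ball 1 ρ_b` (J5's family) against the BOXED REFERENCE member with the potentials frozen to the background value `𝐕₀(Y) = 𝒪(old, φ, Y, 0)`:
`‖m(s₀, b) − c₁(b)‖ ≤ s₀²·(weight L M c Z a t·e^{a₅|Z|})`.  Located inputs: W1-8's list at the base point as in J6 ∕ J7a + the PARITY data (boxes even in `B′`, the odd first-order part
`𝒱₁(Y, ·)` of the member's potential `b²·s₀⁻²𝒲(φ,Y,s₀·) + 𝒪(old,φ,Y,s₀·)` about `𝐕₀`, displayed) + the Taylor letters of the source theorem (verbatim, read at `V := b²W_{s₀} + O_{s₀}`,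
`V₀ := 𝐕₀`, `V₁ := 𝒱₁`, `s := s₀`) + `K_E`, `ρ_b < 1`, the primed letters and the numeric conditions in its letters.  The `s₀²·W₁` half of J1's `centred_of_twoStep` ∕ the first piece
of J7a §4 `vertexLetter_of_threePieces`.  One application; no estimate proved here.
[cite: Balaban1988RG2Cluster, (2.14)-(2.15) p.15, (2.16)-(2.22) p.16, (2.23)-(2.26) p.17, (1.41) p.11; Balaban1987RG1, (2.10)-(2.13) pp.267-268] -/
theorem norm_memberOfDatum_sub_boxedCentre_le_of_primitives
    (Z : (domSys P M (k + 1)).Dom) (t : TermLabel P M k L) (old : OlderTerms P 𝔸 M k) (φ : CPair P 𝔸) (s₀ : ℝ) (b : ℂ)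
    (𝒱₁ : TDom P.d (L * domCount P M (k + 1)) → ((𝔇.𝒦 Z t).Λ → ℝ) → ℂ)
    (c : B13.Consts)
    (hκ₁ : 1 ≤ c.κ₁)
    (hα₆ : c.α₆ ≠ 0)
    (hpos : ∀ Y : TDom P.d (L * domCount P M (k + 1)), 0 < invTau c ((tsys P.d (L * domCount P M (k + 1))).dj Y))
    (hhalf : ∀ Y : TDom P.d (L * domCount P M (k + 1)), invTau c ((tsys P.d (L * domCount P M (k + 1))).dj Y) ≤ 1 / 2)
    {Uσ : Set ℂ}
    {Uτ : TDom P.d (L * domCount P M (k + 1)) → Set ℂ}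
    (hUσ : IsOpen Uσ)
    (hUτ : ∀ Y, IsOpen (Uτ Y))
    (hUexp : closedBall (0 : ℂ) (Real.exp c.κ₁) ⊆ Uσ)
    (hUtau : ∀ Y : TDom P.d (L * domCount P M (k + 1)), closedBall (0 : ℂ) ((invTau c ((tsys P.d (L * domCount P M (k + 1))).dj Y))⁻¹) ⊆ Uτ Y)
    (hr : 0 < 𝔇.r)
    (hr' : 𝔇.r ≤ Real.exp c.κ₁ - 1)
    (hsubτ : ∀ Y, ∀ s ∈ Set.uIcc (0 : ℝ) 1, closedBall (s : ℂ) 𝔇.r ⊆ Uτ Y)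
    -- the (2.14)-data AT THE REAL COUPLING (b = 1)
    (hχ0 : ∀ B, 0 ≤ χu Z t (s₀ • B))
    (hχc0 : ∀ B, 0 ≤ χcu Z t (s₀ • B))
    (hχe : ∀ B, χu Z t (s₀ • (-B)) = χu Z t (s₀ • B))
    (hχce : ∀ B, χcu Z t (s₀ • (-B)) = χcu Z t (s₀ • B))
    (hAhol : ∀ i j, DifferentiableOn ℂ (fun σ => 𝔇.A Z t φ σ i j) {σ | ∀ j, σ j ∈ Uσ})
    (hχm : Measurable fun B : (𝔇.𝒦 Z t).Λ → ℝ => χu Z t (s₀ • B))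
    (hχcm : Measurable fun B : (𝔇.𝒦 Z t).Λ → ℝ => χcu Z t (s₀ • B))
    (hVm : ∀ Y, Measurable fun B : (𝔇.𝒦 Z t).Λ → ℝ => b ^ 2 * ((((s₀ : ℝ) : ℂ) ^ 2)⁻¹ * 𝒲 Z t φ Y (s₀ • B)) + 𝒪 Z t old φ Y (s₀ • B))
    (hV₀m : ∀ Y, Measurable fun _B : (𝔇.𝒦 Z t).Λ → ℝ => 𝒪 Z t old φ Y 0)
    (hV₁m : ∀ Y, Measurable (𝒱₁ Y))
    (hV₁o : ∀ Y B, 𝒱₁ Y (-B) = -𝒱₁ Y B)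
    (hAs : ∀ σ : TPt P.d (domCount P M (k + 1)) → ℂ, (∀ j, σ j ∈ Uσ) → (𝔇.A Z t φ σ).IsSymm)
    (hGhol : ∀ i j, DifferentiableOn ℂ (fun σ => (𝔇.𝒦 Z t).G2 σ (𝔇.uOf Z t φ) i j) {σ | ∀ j, σ j ∈ Uσ})
    -- (2.22); (2.20) for 𝐕, the centre's bound, and the EXPONENTIAL Taylor letters, on the open per-domain τ-region
    {γ₂ rP a₂₀ w w₀ K₁ a₁ K₂ a₂ ac wc : ℝ}
    (qP : ((𝔇.𝒦 Z t).Λ → ℝ) → ℝ)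
    (h222 : ∀ B, χu Z t (s₀ • B) * χcu Z t (s₀ • B) ≤ Real.exp (-(γ₂ / 2 * rP ^ 2 * (t.2.card : ℕ)) + γ₂ / 2 * qP B))
    (hγ₂ : 0 ≤ γ₂)
    (hqP : ∀ B, qP B ≤ B ⬝ᵥ B)
    (ha₂₀ : 0 ≤ a₂₀)
    (h220U : ∀ τ : TDom P.d (L * domCount P M (k + 1)) → ℂ, (∀ Y, τ Y ∈ Uτ Y) →
      ∀ B, ∑ Y ∈ t.1, ‖τ Y‖ * ‖b ^ 2 * ((((s₀ : ℝ) : ℂ) ^ 2)⁻¹ * 𝒲 Z t φ Y (s₀ • B)) + 𝒪 Z t old φ Y (s₀ • B)‖ ≤ a₂₀ / 2 * (B ⬝ᵥ B) + w)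
    (hw₀U : ∀ τ : TDom P.d (L * domCount P M (k + 1)) → ℂ, (∀ Y, τ Y ∈ Uτ Y) → ∀ B : (𝔇.𝒦 Z t).Λ → ℝ, ∑ Y ∈ t.1, ‖τ Y‖ * ‖𝒪 Z t old φ Y 0‖ ≤ w₀)
    (hs : 0 ≤ s₀)
    (hK₁ : 0 ≤ K₁)
    (hK₂ : 0 ≤ K₂)
    (ha₁ : 0 ≤ a₁)
    (h1eU : ∀ τ : TDom P.d (L * domCount P M (k + 1)) → ℂ, (∀ Y, τ Y ∈ Uτ Y) →
      ∀ B, ∑ Y ∈ t.1, ‖τ Y‖ * ‖(b ^ 2 * ((((s₀ : ℝ) : ℂ) ^ 2)⁻¹ * 𝒲 Z t φ Y (s₀ • B)) + 𝒪 Z t old φ Y (s₀ • B)) - 𝒪 Z t old φ Y 0‖ ≤ s₀ * (K₁ * Real.exp (a₁ / 2 * (B ⬝ᵥ B))))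
    (h2eU : ∀ τ : TDom P.d (L * domCount P M (k + 1)) → ℂ, (∀ Y, τ Y ∈ Uτ Y) →
      ∀ B, ∑ Y ∈ t.1, ‖τ Y‖ * ‖(b ^ 2 * ((((s₀ : ℝ) : ℂ) ^ 2)⁻¹ * 𝒲 Z t φ Y (s₀ • B)) + 𝒪 Z t old φ Y (s₀ • B)) - 𝒪 Z t old φ Y 0 - 𝒱₁ Y B‖ ≤ s₀ ^ 2 * (K₂ * Real.exp (a₂ / 2 * (B ⬝ᵥ B))))
    (hac₀ : a₂₀ ≤ ac)
    (hac₂ : a₂ ≤ ac)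
    (hac₁ : 2 * a₁ + a₂₀ ≤ ac)
    (hwc : Real.exp w₀ * (K₂ + K₁ ^ 2 * Real.exp (w + w₀)) ≤ Real.exp wc)
    -- bonds located on the torus `UT Nf`
    (hfibN : ∀ x : UT 𝔇.Nf, (Finset.univ.filter fun j => (𝔇.𝒦 Z t).locN j = x).card ≤ (𝔇.𝒦 Z t).m)
    -- rates and the letters AT b = 1 (+ K_E)
    {kap kap' kap'' θ θE θΓ θC KG KΓ KCs K₀ KE : ℝ}
    (hkap'' : 0 < kap'')
    (hk1 : kap'' < kap')
    (hk2 : kap' < kap)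
    (hθE : 0 ≤ θE)
    (hθΓ : 0 ≤ θΓ)
    (hθC : 0 ≤ θC)
    (hKG : 0 ≤ KG)
    (hKΓ : 0 ≤ KΓ)
    (hKCs : 0 ≤ KCs)
    (hK₀ : 0 ≤ K₀)
    (hKE : 0 ≤ KE)
    (hG : ∀ σ : TPt P.d (domCount P M (k + 1)) → ℂ, (∀ j, σ j ∈ Uσ) →
      ∀ b j, ‖(𝔇.𝒦 Z t).G2 σ (𝔇.uOf Z t φ) b j‖ ≤ KG * Real.exp (-(kap * tdist1 𝔇.Nf ((𝔇.𝒦 Z t).locΛ b) ((𝔇.𝒦 Z t).locN j))))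
    (hΓ₀ : ∀ b j, ‖(𝔇.𝒦 Z t).Γ₀ b j‖ ≤ KΓ * Real.exp (-(kap * tdist1 𝔇.Nf ((𝔇.𝒦 Z t).locΛ b) ((𝔇.𝒦 Z t).locN j))))
    (hCs : ∀ σ : TPt P.d (domCount P M (k + 1)) → ℂ, (∀ j, σ j ∈ Uσ) →
      ∀ b b', ‖(𝔇.A Z t φ σ)⁻¹ b b'‖ ≤ KCs * Real.exp (-(kap * tdist1 𝔇.Nf ((𝔇.𝒦 Z t).locΛ b) ((𝔇.𝒦 Z t).locΛ b'))))
    (hC216 : ∀ b b', ‖(𝔇.𝒦 Z t).C b b'‖ ≤ K₀ * Real.exp (-(kap * tdist1 𝔇.Nf ((𝔇.𝒦 Z t).locΛ b) ((𝔇.𝒦 Z t).locΛ b'))))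
    (hCE : ∀ b b', ‖((𝔇.𝒦 Z t).C⁻¹.map (algebraMap ℝ ℂ)) b b'‖ ≤ KE * Real.exp (-(kap * tdist1 𝔇.Nf ((𝔇.𝒦 Z t).locΛ b) ((𝔇.𝒦 Z t).locΛ b'))))
    (hdΓ : ∀ σ : TPt P.d (domCount P M (k + 1)) → ℂ, (∀ j, σ j ∈ Uσ) →
      ∀ b j, ‖((𝔇.𝒦 Z t).G2 σ (𝔇.uOf Z t φ) - (𝔇.𝒦 Z t).Γ₀.map (algebraMap ℝ ℂ)) b j‖ ≤ θΓ * Real.exp (-(kap * tdist1 𝔇.Nf ((𝔇.𝒦 Z t).locΛ b) ((𝔇.𝒦 Z t).locN j))))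
    (hdC : ∀ σ : TPt P.d (domCount P M (k + 1)) → ℂ, (∀ j, σ j ∈ Uσ) →
      ∀ b b', ‖((𝔇.A Z t φ σ)⁻¹ - (𝔇.𝒦 Z t).C.map (algebraMap ℝ ℂ)) b b'‖
        ≤ θC * Real.exp (-(kap * tdist1 𝔇.Nf ((𝔇.𝒦 Z t).locΛ b) ((𝔇.𝒦 Z t).locΛ b'))))
    (hdE : ∀ σ : TPt P.d (domCount P M (k + 1)) → ℂ, (∀ j, σ j ∈ Uσ) →
      ∀ b b', ‖(𝔇.A Z t φ σ - (𝔇.𝒦 Z t).C⁻¹.map (algebraMap ℝ ℂ)) b b'‖ ≤ θE * Real.exp (-(kap * tdist1 𝔇.Nf ((𝔇.𝒦 Z t).locΛ b) ((𝔇.𝒦 Z t).locΛ b'))))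
    {ρb KG' KCs' θΓ' θC' θE' : ℝ}
    (hρb1 : ρb < 1)
    (hKG' : (1 + ρb) * KG ≤ KG')
    (hKCs' : ((1 - ρb) ^ 2)⁻¹ * KCs ≤ KCs')
    (hθΓ' : θΓ + ρb * KG ≤ θΓ')
    (hθC' : θC + ρb * (2 + ρb) * ((1 - ρb) ^ 2)⁻¹ * KCs ≤ θC')
    (hθE' : θE + ρb * (2 + ρb) * (θE + KE) ≤ θE')
    -- the capstone's numeric conditions in the primed letters, at the master rate γ₂ + a_c, with w_c
    (hθEle : θE' ≤ θ)
    (hθΓle : θΓ' ≤ θ)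
    (hθR1le : ((𝔇.𝒦 Z t).m * (1 + 2 / (kap - kap')) ^ 𝔇.ν) * ((𝔇.𝒦 Z t).m * (1 + 2 / (kap' - kap'')) ^ 𝔇.ν)
      * (θΓ' * KCs' * KG' + KΓ * θC' * KG' + KΓ * K₀ * θΓ') ≤ θ)
    (hsmallKθ : K₀ * ((𝔇.𝒦 Z t).m * (1 + 2 / kap) ^ 𝔇.ν) * (θ * ((𝔇.𝒦 Z t).m * (1 + 2 / kap'') ^ 𝔇.ν)) < 1)
    {cE g : ℝ}
    (hc0 : 0 ≤ cE)
    (hc : ∀ k, (𝔇.𝒦 Z t).hC.1.eigenvalues k ≤ cE)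
    (hαc : (2 * (θ * ((𝔇.𝒦 Z t).m * (1 + 2 / kap'') ^ 𝔇.ν)) + (γ₂ + ac)) * cE ≤ 1 / 2)
    (hg : 0 ≤ g)
    (hΓq : ∀ X : (𝔇.𝒦 Z t).Λ ⊕ (𝔇.𝒦 Z t).C₀ → ℝ, ((𝔇.𝒦 Z t).Γ₀ *ᵥ X) ⬝ᵥ ((𝔇.𝒦 Z t).C *ᵥ ((𝔇.𝒦 Z t).Γ₀ *ᵥ X)) ≤ g * (X ⬝ᵥ X))
    (hsmall : (2 * (θ * ((𝔇.𝒦 Z t).m * (1 + 2 / kap'') ^ 𝔇.ν)) + (γ₂ + ac)) * (1 + 2 * cE * g) ≤ 1 / 2)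
    {a a₅ : ℝ}
    (hPa : a ≤ γ₂ * rP ^ 2)
    (hvol : 2 * (K₀ * ((𝔇.𝒦 Z t).m * (1 + 2 / kap) ^ 𝔇.ν) * (θ * ((𝔇.𝒦 Z t).m * (1 + 2 / kap'') ^ 𝔇.ν))
              * (1 + (1 - K₀ * ((𝔇.𝒦 Z t).m * (1 + 2 / kap) ^ 𝔇.ν) * (θ * ((𝔇.𝒦 Z t).m * (1 + 2 / kap'') ^ 𝔇.ν)))⁻¹) / 2)
          * (Fintype.card (𝔇.𝒦 Z t).Λ : ℝ)
        + wc + (2 * (θ * ((𝔇.𝒦 Z t).m * (1 + 2 / kap'') ^ 𝔇.ν)) + (γ₂ + ac)) * cE * (Fintype.card (𝔇.𝒦 Z t).Λ : ℝ)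
        + (2 * (θ * ((𝔇.𝒦 Z t).m * (1 + 2 / kap'') ^ 𝔇.ν)) + (γ₂ + ac)) * (1 + 2 * cE * g) * (Fintype.card ((𝔇.𝒦 Z t).Λ ⊕ (𝔇.𝒦 Z t).C₀) : ℝ)
        ≤ a₅ * ((Z.1).card : ℝ))
    (hb : b ∈ ball (1 : ℂ) ρb) :
    ‖term214 𝔇.r (sigmaList L Z t) (tauList P M k L t)
        (core214 (fun σ => b ^ 2 • 𝔇.A Z t φ σ) (fun σ X => b • 𝔇.Gam Z t φ σ X)
          (F214 t.2.card (fun B => χu Z t (s₀ • B)) (fun B => χcu Z t (s₀ • B)) t.1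
            (fun Y B => b ^ 2 * ((((s₀ : ℝ) : ℂ) ^ 2)⁻¹ * 𝒲 Z t φ Y (s₀ • B)) + 𝒪 Z t old φ Y (s₀ • B)))) 0 0
      - term214 𝔇.r (sigmaList L Z t) (tauList P M k L t)
        (core214 (fun σ => b ^ 2 • 𝔇.A Z t φ σ) (fun σ X => b • 𝔇.Gam Z t φ σ X)
          (F214 t.2.card (fun B => χu Z t (s₀ • B)) (fun B => χcu Z t (s₀ • B)) t.1 (fun Y _ => 𝒪 Z t old φ Y 0))) 0 0‖ ≤
      s₀ ^ 2 * (weight L M c Z a t * Real.exp (a₅ * ((Z.1).card : ℝ))) :=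
  h226_torus_windowDilated_centred_of_primitives_exp c hκ₁ hα₆ Z t hpos hhalf hUσ hUτ hUexp hUtau hr hr' hsubτ (sigmaList L Z t) (sigmaList_spec Z t) (tauList P M k L t) (tauList_spec t) (𝔇.A Z t φ) (𝔇.Gam Z t φ) (χY₀ := fun B => χu Z t (s₀ • B)) (χcP := fun B => χcu Z t (s₀ • B)) hχ0 hχc0 hχe hχce t.1 (V := (fun Y B => b ^ 2 * ((((s₀ : ℝ) : ℂ) ^ 2)⁻¹ * 𝒲 Z t φ Y (s₀ • B)) + 𝒪 Z t old φ Y (s₀ • B))) (V₀ := (fun Y _ => 𝒪 Z t old φ Y 0)) (V₁ := 𝒱₁) (𝔇.𝒦 Z t).hC (𝔇.𝒦 Z t).Γ₀ hAhol hχm hχcm hVm hV₀m hV₁m (fun _ _ => rfl) hV₁o hAs (fun σ => (𝔇.𝒦 Z t).G2 σ (𝔇.uOf Z t φ)) hGhol (fun _ _ _ => rfl) (s := s₀) qP h222 hγ₂ hqP ha₂₀ h220U hw₀U hs hK₁ hK₂ ha₁ h1eU h2eU hac₀ hac₂ hac₁ hwc (𝔇.𝒦 Z t).locΛ (𝔇.𝒦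 Z t).locN (𝔇.𝒦 Z t).hfib hfibN hkap'' hk1 hk2 hθE hθΓ hθC hKG hKΓ hKCs hK₀ hKE hG hΓ₀ hCs hC216 hCE hdΓ hdC hdE hρb1 hKG' hKCs' hθΓ' hθC' hθE' hθEle hθΓle hθR1le hsmallKθ hc0 hc hαc hg hΓq hsmall hPa hvol (b := b) hb

end YMDAG.N22.W1

end
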